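import Mathlib
import Summits.Ventures.PercRepro2.Defs
import Summits.Ventures.PercRepro2.Graph
import Summits.Ventures.PercRepro2.OneColourSwitch
import Summits.Ventures.PercRepro2.RegionHubSign
import Summits.Ventures.PercRepro2.SideSwitch
import Summits.Ventures.PercRepro2.SideSwitchFibre
import Summits.Ventures.PercRepro2.SideSwitchMono
import Summits.Ventures.PercRepro2.SideSwitchM9
import Summits.Ventures.PercRepro2.SideSwitchClosed
import Summits.Ventures.PercRepro2.SideSwitchComps
import Summits.Ventures.PercRepro2.SideSwitchCompsFibre
import Summits.Ventures.PercRepro2.SideSwitchCompsMono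
import Summits.Ventures.PercRepro2.SideSwitchCompsM9

/-!
# The `DZero` part of the `m9` sign sum is non-positive on EVERY graph (blind cell PercRepro2,
p3 g19, 2026-08-27; `proofs/P3-CPNC.md` §16d, §16h)

`dzeroSignSum ends p q r s := Σ_{ω ∈ Sep, D(ω) = ∅} σ_pq(ω) σ_rs(ω)` — the sum over the
`Sep`-colourings in which no non-mark is doubly reached from `{r, s}` — satisfies
`dzeroSignSum ≤ 0` for every finite marked multigraph (`dzeroSignSum_nonpos`): the case
`D₀ = ∅` of the census-true family `Σ_{D(ω) ⊆ D₀} σ_pq σ_rs ≤ 0`, and the load-bearing negative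
part of `m9` (the `D ≠ ∅` part is positive on some graphs, §16d).  Proof: the side-switch
fibration of `SideSwitchCompsFibre` restricted to the `DZero` colourings — they are exactly the
component assignments of the representatives (`DZero_assignC`, `sum_sep_dzero_eq_sum_rep_comps`)
— and the Harris step of `SideSwitchCompsM9` verbatim.  Own work, one seat.
-/

namespace Summit.Ventures.PercRepro2

namespace SideSwitch

open Finset Classical RegionHub OneColourSwitch

variable {V : Type*} {E : Type*}

section DZeroPart

variable [Fintype V] [DecidableEq V] [Fintype E] [DecidableEq E]

variable {ends : E → Sym2 V}

/-- A component assignment of a representative has no doubly reached non-mark. -/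
lemma DZero_assignC {p q r s : V} {ρ : Config E} (hρ : ρ ∈ Rep ends p q r s)
    {T : Finset (Finset V)} (hT : T ⊆ comps ends r s ρ) : DZero ends r s (assignC ends T ρ) := by
  obtain ⟨h, hM⟩ := mem_Rep.1 hρ
  obtain ⟨h1, h2, h3, h4⟩ := switch_data_unionT hT
  intro x hr hs hK hMx
  simp only [assignC, assign] at hK hMx
  rw [K2_flipTouch_of_closed h h1 h2 h3 h4] at hK
  rw [M2_flipTouch_of_closed h h1 h2 h3 h4] at hMx
  rcases hK with ⟨_, hxT⟩ | ⟨_, hxM⟩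
  · rcases hMx with ⟨hxM, _⟩ | ⟨hxT', _⟩
    · rcases hM x hxM with h' | h'
      · exact hr h'
      · exact hs h'
    · exact hxT hxT'
  · rcases hM x hxM with h' | h'
    · exact hr h'
    · exact hs h'

/-- The `DZero` colourings. -/
noncomputable def DZeroSet (ends : E → Sym2 V) (p q r s : V) : Finset (Config E) :=
  (SepSet ends p q r s).filter (fun ω => DZero ends r s ω)

omit [Fintype V] [DecidableEq V] in
/-- Membership in the `DZero` colourings. -/
lemma mem_DZeroSet {p q r s : V} {ω : Config E} :
    ω ∈ DZeroSet ends p q r s ↔ sep2 ends p q r s ω ∧ DZero ends r s ω := by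
  simp [DZeroSet, SepSet]

/-- **The `DZero` colourings of ANY graph are fibred over the representatives by the component
assignments.** -/
theorem sum_sep_dzero_eq_sum_rep_comps {p q r s : V} (f : Config E → ℤ) :
    ∑ ω ∈ DZeroSet ends p q r s, f ω =
      ∑ ρ ∈ Rep ends p q r s, ∑ T ∈ (comps ends r s ρ).powerset, f (assignC ends T ρ) := by
  have hmaps : ∀ ω ∈ DZeroSet ends p q r s, nu ends r s ω ∈ Rep ends p q r s := fun ω hω =>
    nu_mem_Rep_of_DZero (mem_DZeroSet.1 hω).1 (mem_DZeroSet.1 hω).2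
  rw [← Finset.sum_fiberwise_of_maps_to hmaps]
  refine Finset.sum_congr rfl (fun ρ hρ => ?_)
  refine Finset.sum_nbij' (fun ω => (comps ends r s ρ).filter (fun C => C ⊆ Bside ends r s ω))
    (fun T => assignC ends T ρ) ?_ ?_ ?_ ?_ ?_
  · intro ω _
    exact Finset.mem_powerset.2 (Finset.filter_subset _ _)
  · intro T hT
    rw [Finset.mem_powerset] at hT
    rw [Finset.mem_filter, mem_DZeroSet]
    exact ⟨⟨sep2_assignC (mem_Rep.1 hρ).1 hT, DZero_assignC hρ hT⟩, nu_assignC hρ hT⟩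
  · intro ω hω
    rw [Finset.mem_filter] at hω
    obtain ⟨hωS, hων⟩ := hω
    obtain ⟨hsep, hDω⟩ := mem_DZeroSet.1 hωS
    have hcomps : comps ends r s ρ = comps ends r s ω := by
      rw [← hων]
      have hB := closedIn_Bside hsep hDω
      obtain ⟨hC, hCr, hCs⟩ := subset_U2_of_subset_A0 (Bside_subset_A0 (ends := ends) r s ω)
      simp only [comps, nu]
      have hA : A0 ends r s (flipTouch ends (↑(Bside ends r s ω) : Set V) ω) = A0 ends r s ω := by
        ext x
        simp only [mem_A0]
        rw [U2_flipTouch_of_closed hsep hC hCr hCs hB]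
      rw [hA]
    rw [hcomps, assignC, unionT_filter_Bside hsep hDω, ← hων, nu, assign, flipTouch_flipTouch]
  · intro T hT
    rw [Finset.mem_powerset] at hT
    rw [Bside_assignC hρ hT, filter_subset_unionT hT]
  · intro ω hω
    rw [Finset.mem_filter] at hω
    obtain ⟨hωS, hων⟩ := hω
    obtain ⟨hsep, hDω⟩ := mem_DZeroSet.1 hωS
    have hcomps : comps ends r s ρ = comps ends r s ω := by
      rw [← hων]
      have hB := closedIn_Bside hsep hDω
      obtain ⟨hC, hCr, hCs⟩ := subset_U2_of_subset_A0 (Bside_subset_A0 (ends := ends) r s ω)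
      simp only [comps, nu]
      have hA : A0 ends r s (flipTouch ends (↑(Bside ends r s ω) : Set V) ω) = A0 ends r s ω := by
        ext x
        simp only [mem_A0]
        rw [U2_flipTouch_of_closed hsep hC hCr hCs hB]
      rw [hA]
    rw [hcomps, assignC, unionT_filter_Bside hsep hDω, ← hων, nu, assign, flipTouch_flipTouch]

/-- The `DZero` part of the `m9` sign sum: `Σ_{ω ∈ Sep, D(ω) = ∅} σ_pq · σ_rs`. -/
noncomputable def dzeroSignSum (ends : E → Sym2 V) (p q r s : V) : ℤ :=
  ∑ ω : Config E, if sep2 ends p q r s ω ∧ DZero ends r s ω then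
    sigma ends ω p q * sigma ends ω r s else 0

/-- **The `DZero` part of `m9` is non-positive on every graph**:
`Σ_{ω ∈ Sep, D(ω) = ∅} σ_pq · σ_rs ≤ 0`. -/
theorem dzeroSignSum_nonpos (p q r s : V) : dzeroSignSum ends p q r s ≤ 0 := by
  have hsum : dzeroSignSum ends p q r s =
      ∑ ρ ∈ Rep ends p q r s, ∑ T ∈ (comps ends r s ρ).powerset,
        sigma ends (assignC ends T ρ) p q * sigma ends (assignC ends T ρ) r s := by
    rw [dzeroSignSum, ← Finset.sum_filter]
    rw [← sum_sep_dzero_eq_sum_rep_comps (fun ω => sigma ends ω p q * sigma ends ω r s)]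
    refine Finset.sum_congr ?_ (fun _ _ => rfl)
    ext ω
    simp [DZeroSet, SepSet]
  have hsumO : (∑ ρ ∈ Rep ends p q r s, ∑ T ∈ (comps ends r s ρ).powerset,
        sigma ends (assignC ends T ρ) p q * sigma ends (assignC ends T ρ) r s) =
      ∑ ρ ∈ Rep ends p q r s, ∑ T ∈ (comps ends r s ρ).powerset,
        sigma ends (assignC ends T (flipO ends r s ρ)) p q *
          sigma ends (assignC ends T ρ) r s := by
    symm
    refine Finset.sum_nbij' (fun ρ => flipO ends r s ρ) (fun ρ => flipO ends r s ρ)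
      (fun ρ hρ => flipO_mem_Rep hρ) (fun ρ hρ => flipO_mem_Rep hρ)
      (fun ρ _ => flipO_flipO r s ρ) (fun ρ _ => flipO_flipO r s ρ) ?_
    intro ρ hρ
    rw [comps_flipO]
    refine Finset.sum_congr rfl (fun T hT => ?_)
    rw [sigma_rs_assignC_flipO hρ (Finset.mem_powerset.1 hT)]
  have hkey : ∀ ρ ∈ Rep ends p q r s,
      ∑ T ∈ (comps ends r s ρ).powerset,
        (sigma ends (assignC ends T ρ) p q +
          sigma ends (assignC ends T (flipO ends r s ρ)) p q) *
          sigma ends (assignC ends T ρ) r s ≤ 0 := by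
    intro ρ hρ
    set A := comps ends r s ρ with hA
    let Yc : Finset (Finset V) → ℤ := fun T => if Conn ends (assignC ends T ρ) p q then 1 else 0
    let Yc' : Finset (Finset V) → ℤ := fun T =>
      if Conn ends (assignC ends T (flipO ends r s ρ)) p q then 1 else 0
    let G : Finset (Finset V) → ℤ := fun T => Yc T + Yc' T
    let D : Finset (Finset V) → ℤ := fun T => G T - G (A \ T)
    let S : Finset (Finset V) → ℤ := fun T => sigma ends (assignC ends T ρ) r s
    have hρO := flipO_mem_Rep hρ
    have hmonoYc : ∀ T T', T ⊆ T' → T' ⊆ A → Yc T ≤ Yc T' := by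
      intro T T' hTT hT'
      exact ite_le_ite_of_imp (conn_pq_assignC_mono hρ hTT hT')
    have hmonoYc' : ∀ T T', T ⊆ T' → T' ⊆ A → Yc' T ≤ Yc' T' := by
      intro T T' hTT hT'
      have hT'O : T' ⊆ comps ends r s (flipO ends r s ρ) := by rw [comps_flipO]; exact hT'
      exact ite_le_ite_of_imp (conn_pq_assignC_mono hρO hTT hT'O)
    have hmonoD : ∀ T T', T ⊆ T' → T' ⊆ A → D T ≤ D T' := by
      intro T T' hTT hT'
      have h1 := hmonoYc T T' hTT hT'
      have h2 := hmonoYc' T T' hTT hT'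
      have h3 := hmonoYc (A \ T') (A \ T) (Finset.sdiff_subset_sdiff (Finset.Subset.refl A) hTT)
        Finset.sdiff_subset
      have h4 := hmonoYc' (A \ T') (A \ T) (Finset.sdiff_subset_sdiff (Finset.Subset.refl A) hTT)
        Finset.sdiff_subset
      simp only [D, G]
      linarith
    have hantiS : ∀ T T', T ⊆ T' → T' ⊆ A → S T' ≤ S T := by
      intro T T' hTT hT'
      show sigma ends (assignC ends T' ρ) r s ≤ sigma ends (assignC ends T ρ) r s
      unfold sigma
      exact sub_le_sub (ite_le_ite_of_imp (conn_rs_assignC_anti hρ hTT hT'))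
        (ite_le_ite_of_imp (conn_rs_compl_assignC_mono hρ hTT hT'))
    have h0 : ∑ T ∈ A.powerset, D T = 0 := by
      simp only [D]
      rw [Finset.sum_sub_distrib, sum_powerset_sdiff, sub_self]
    have hH := sum_mul_nonpos_of_monotone_antitone A D S hmonoD hantiS h0
    refine le_trans (le_of_eq ?_) hH
    refine Finset.sum_congr rfl (fun T hT => ?_)
    rw [sigma_pq_add_flipO_C hρ (Finset.mem_powerset.1 hT)]
  have htwice : 2 * dzeroSignSum ends p q r s ≤ 0 := by
    calc 2 * dzeroSignSum ends p q r s
        = dzeroSignSum ends p q r s + dzeroSignSum ends p q r s := by ring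
      _ = (∑ ρ ∈ Rep ends p q r s, ∑ T ∈ (comps ends r s ρ).powerset,
            sigma ends (assignC ends T ρ) p q * sigma ends (assignC ends T ρ) r s) +
          ∑ ρ ∈ Rep ends p q r s, ∑ T ∈ (comps ends r s ρ).powerset,
            sigma ends (assignC ends T (flipO ends r s ρ)) p q *
              sigma ends (assignC ends T ρ) r s := by
          rw [← hsumO, ← hsum]
      _ = ∑ ρ ∈ Rep ends p q r s, ∑ T ∈ (comps ends r s ρ).powerset,
            (sigma ends (assignC ends T ρ) p q +
              sigma ends (assignC ends T (flipO ends r s ρ)) p q) *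
              sigma ends (assignC ends T ρ) r s := by
          rw [← Finset.sum_add_distrib]
          refine Finset.sum_congr rfl (fun ρ _ => ?_)
          rw [← Finset.sum_add_distrib]
          refine Finset.sum_congr rfl (fun T _ => ?_)
          ring
      _ ≤ 0 := Finset.sum_nonpos (fun ρ hρ => hkey ρ hρ)
  linarith

end DZeroPart

end SideSwitch

end Summit.Ventures.PercRepro2
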